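import Mathlib.GroupTheory.OrderOfElement
import Mathlib.Algebra.Group.Subgroup.Map
import Mathlib.Algebra.Group.Pi.Lemmas
import Mathlib.Data.Fintype.Pi
import Mathlib.Data.Int.GCD
import Mathlib.Data.Nat.GCD.BigOperators
import Mathlib.Algebra.BigOperators.Group.Finset.Piecewise
import HarnessLib

/-!
# Crux `Capture` (stmt-PneNP-2659), line `csp-spine-meet-to-join` — stub `stub_cosetUnsatCoprimePi`
# (coset CSPs over a finite product of groups of pairwise coprime orders split coordinatewise)

Skeleton rev 5 (lead c2) of line `csp-spine-meet-to-join` reduces coset CSPs over finite NILPOTENT groups to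
their Sylow subgroups; this file is the pure group theory behind that step. Let `G p` (`p : κ`, `κ` finite)
be finite groups of pairwise coprime orders and `K` a subgroup of `(Π p, G p)^I`. For every `k ∈ K` and
every coordinate `p` the `p`-part `fun i => Pi.mulSingle p (k i p)` of `k` is a POWER of `k` (raise `k` to
`N_p = ∏_{q ≠ p} |G q|`, which kills every coordinate `q ≠ p` and is coprime to `|G p|`, then undo the power
map on `G p` by a Bézout exponent), hence lies in `K` (`cosetPi_mulSingle_mem`); so `K` is the product of
its coordinate projections (`cosetPi_mem_of_proj`). Consequently a system of selected coset constraints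
over `Π p, G p` has no common solution iff for some coordinate `p` the `p`-projected system (subgroups
`(H j).map (compLeft (eval p))`, representatives `c j i p`) has none (`stub_cosetUnsatCoprimePi`, the
registered signature, proved exactly). This is the finite-product form of the landed binary statement
`coset_unsat_coprime_prod` (`Theorems/ConvexRankGatesCaptureCoprimeSplit.lean`), whose power-map argument
is adapted here; that file is deliberately NOT imported. Mathlib only. 2026-08-16. [folklore]
-/

namespace Summit.PneNP.PneNP.Cruxes.Capture.CspSpineMeetToJoin

set_option linter.dupNamespace false -- `Summit.PneNP.PneNP.…`: summit = sub-problem (D-0017)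

/-- **Power maps are undone by power maps.** In a finite group `P` whose order is coprime to `e` there is
an exponent `M` with `(k ^ e) ^ M = k` for every `k : P` (Bézout: `e * M ≡ 1 (mod |P|)`; `M = 0` when
`|P| = 1`). Adapted from the proof of `coset_unsat_coprime_prod`. [folklore] -/
theorem cosetPi_pow_undo (P : Type) [Group P] [Fintype P] (e : ℕ) (he : (Fintype.card P).Coprime e) :
    ∃ M : ℕ, ∀ k : P, (k ^ e) ^ M = k := by
  -- adapted from `coset_unsat_coprime_prod` (Theorems/ConvexRankGatesCaptureCoprimeSplit.lean)
  by_cases h1 : Fintype.card P = 1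
  · refine ⟨0, fun k => ?_⟩
    haveI : Subsingleton P := Fintype.card_le_one_iff_subsingleton.1 h1.le
    exact Subsingleton.elim _ _
  · have hlt : 1 < Fintype.card P := lt_of_le_of_ne Fintype.card_pos (Ne.symm h1)
    obtain ⟨M, -, hM⟩ := Nat.exists_mul_mod_eq_one_of_coprime (k := Fintype.card P) (n := e) he.symm hlt
    refine ⟨M, fun k => ?_⟩
    rw [← pow_mul, ← pow_mod_card (n := e * M), hM, pow_one]

/-- **`p`-parts stay in the subgroup.** If the finite groups `G p` have pairwise coprime orders, then every
subgroup `K` of `I → Π p, G p` contains, with each element `k`, its `p`-part `fun i => Pi.mulSingle p (k i p)`: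
it equals `(k ^ N) ^ M` for `N = ∏_{q ≠ p} |G q|` and `M` from `cosetPi_pow_undo`. [folklore] -/
theorem cosetPi_mulSingle_mem {κ : Type} [Fintype κ] [DecidableEq κ] {G : κ → Type} [∀ p, Group (G p)]
    [∀ p, Fintype (G p)] (hcop : ∀ p q, p ≠ q → (Fintype.card (G p)).Coprime (Fintype.card (G q)))
    {I : Type} (K : Subgroup (I → (∀ p, G p))) {k : I → (∀ p, G p)} (hk : k ∈ K) (p : κ) :
    (fun i => Pi.mulSingle p (k i p)) ∈ K := by
  -- `N` kills every coordinate `q ≠ p` and is coprime to `|G p|`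
  obtain ⟨M, hM⟩ := cosetPi_pow_undo (G p) (∏ q ∈ Finset.univ.erase p, Fintype.card (G q))
    (Nat.Coprime.prod_right fun q hq => hcop p q (Finset.ne_of_mem_erase hq).symm)
  have hkey : (fun i => Pi.mulSingle p (k i p)) =
      (k ^ (∏ q ∈ Finset.univ.erase p, Fintype.card (G q))) ^ M := by
    funext i q
    simp only [Pi.pow_apply]
    by_cases hq : q = p
    · rw [hq, Pi.mulSingle_eq_same, hM]
    · rw [Pi.mulSingle_eq_of_ne hq]
      obtain ⟨t, ht⟩ : Fintype.card (G q) ∣ ∏ q ∈ Finset.univ.erase p, Fintype.card (G q) :=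
        Finset.dvd_prod_of_mem (fun q => Fintype.card (G q)) (Finset.mem_erase.2 ⟨hq, Finset.mem_univ q⟩)
      rw [ht, pow_mul, pow_card_eq_one, one_pow, one_pow]
  rw [hkey]
  exact K.pow_mem (K.pow_mem hk _) _

/-- **Assembling an element from its `p`-parts.** Over `I → Π p, G p` (`κ` finite), an element all of whose
`p`-parts `fun i => Pi.mulSingle p (u i p)` lie in a subgroup `K` lies in `K` (induction on a finset of
coordinates, multiplying the `p`-parts on the left). [folklore] -/
theorem cosetPi_mem_of_mulSingle_mem {κ : Type} [Fintype κ] [DecidableEq κ] {G : κ → Type}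
    [∀ p, Group (G p)] {I : Type} (K : Subgroup (I → (∀ p, G p))) (u : I → (∀ p, G p))
    (hu : ∀ p, (fun i => Pi.mulSingle p (u i p)) ∈ K) : u ∈ K := by
  have key : ∀ S : Finset κ, (fun i q => if q ∈ S then u i q else 1) ∈ K := by
    intro S
    induction S using Finset.induction_on with
    | empty =>
      have h0 : (fun (i : I) (q : κ) => if q ∈ (∅ : Finset κ) then u i q else 1) = 1 := by
        funext i q
        simp
      rw [h0]
      exact K.one_mem
    | insert p S hpS ih =>
      have hins : (fun (i : I) (q : κ) => if q ∈ insert p S then u i q else 1) =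
          (fun i => Pi.mulSingle p (u i p)) * (fun i q => if q ∈ S then u i q else 1) := by
        funext i q
        simp only [Pi.mul_apply, Finset.mem_insert]
        by_cases hq : q = p
        · subst hq
          simp [hpS]
        · simp [hq]
      rw [hins]
      exact K.mul_mem (hu p) ih
  simpa using key Finset.univ

/-- **Subgroups of `(Π p, G p)^I` are products of their projections** (pairwise coprime `|G p|`): if every
coordinate projection `fun i => u i p` of `u` agrees with that of some element of `K`, then `u ∈ K`. [folklore] -/
theorem cosetPi_mem_of_proj {κ : Type} [Fintype κ] [DecidableEq κ] {G : κ → Type} [∀ p, Group (G p)]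
    [∀ p, Fintype (G p)] (hcop : ∀ p q, p ≠ q → (Fintype.card (G p)).Coprime (Fintype.card (G q)))
    {I : Type} (K : Subgroup (I → (∀ p, G p))) (u : I → (∀ p, G p))
    (hu : ∀ p, ∃ k ∈ K, ∀ i, k i p = u i p) : u ∈ K := by
  refine cosetPi_mem_of_mulSingle_mem K u fun p => ?_
  obtain ⟨k, hk, hku⟩ := hu p
  have hpart : (fun i => Pi.mulSingle p (u i p)) = fun i => Pi.mulSingle p (k i p) := by
    funext i
    rw [hku i]
  rw [hpart]
  exact cosetPi_mulSingle_mem hcop K hk p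

/-- **Stub `stub_cosetUnsatCoprimePi` (registered signature, line `csp-spine-meet-to-join`, rev 5).**
Over a product `Π p, G p` of finite groups of pairwise coprime orders, the selected coset constraints
`(c j)⁻¹ * (h ∘ scope j) ∈ H j` (`v j = true`) have no common solution `h : Fin nv → Π p, G p` iff for
some coordinate `p` the `p`-projected constraints (subgroups `(H j).map (compLeft (eval p))`,
representatives `c j i p`) have no common solution `Fin nv → G p`. (`←`: a solution projects to a
`p`-solution for every `p`; `→`: coordinatewise solutions glue, by `cosetPi_mem_of_proj`.) Finite-product
form of `coset_unsat_coprime_prod`. [folklore] -/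
theorem stub_cosetUnsatCoprimePi :
    ∀ (κ : Type) [Fintype κ] [DecidableEq κ] (G : κ → Type) [∀ p, Group (G p)] [∀ p, Fintype (G p)],
      (∀ p q, p ≠ q → (Fintype.card (G p)).Coprime (Fintype.card (G q))) →
      ∀ (nv m : ℕ) (r : Fin m → ℕ) (scope : (j : Fin m) → Fin (r j) → Fin nv)
        (H : (j : Fin m) → Subgroup (Fin (r j) → (∀ p, G p))) (c : (j : Fin m) → Fin (r j) → (∀ p, G p))
        (v : Fin m → Bool),
        (¬ ∃ h : Fin nv → (∀ p, G p), ∀ j, v j = true → (c j)⁻¹ * (fun i => h (scope j i)) ∈ H j) ↔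
        ∃ p, ¬ ∃ h : Fin nv → G p, ∀ j, v j = true →
          (fun i => c j i p)⁻¹ * (fun i => h (scope j i)) ∈
            (H j).map (MonoidHom.compLeft (Pi.evalMonoidHom G p) (Fin (r j))) := by
  intro κ _ _ G _ _ hcop nv m r scope H c v
  constructor
  · -- coordinatewise solutions glue to a solution
    intro hun
    by_contra hall
    push Not at hall
    choose hp hhp using hall
    refine hun ⟨fun x p => hp p x, fun j hj => cosetPi_mem_of_proj hcop (H j) _ fun p => ?_⟩
    obtain ⟨k, hk, hkeq⟩ := Subgroup.mem_map.1 (hhp p j hj)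
    refine ⟨k, hk, fun i => ?_⟩
    have hi := congrFun hkeq i
    simpa using hi
  · -- a solution projects to a `p`-solution
    rintro ⟨p, hp⟩ ⟨h, hh⟩
    refine hp ⟨fun x => h x p, fun j hj => Subgroup.mem_map.2 ⟨_, hh j hj, ?_⟩⟩
    funext i
    simp

end Summit.PneNP.PneNP.Cruxes.Capture.CspSpineMeetToJoin
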